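import Literature.NumberTheory.Sieve.FractionPhasesLocal
import Literature.NumberTheory.Sieve.FractionPhasesProduct
import Literature.NumberTheory.LFunctions.GcdSumBounds
import HarnessLib

/-!
# Incomplete sums of two fraction phases with a smooth weight (Polymath 8a, Corollary 4.16), modulo Lemma 4.2

Topic `Literature/NumberTheory/Sieve`, grouping namespace `Polymath8a`; a support file for the named
fact `Literature.NumberTheory.Sieve.mpz_of_lt` (**parity.S29**).  Source: D. H. J. Polymath,
*New equidistribution estimates of Zhang type*, arXiv:1402.0811, **Corollary 4.16** (second, "variant"
bound) — the exponential-sum input of the Type II estimate (Proposition 5.10) — and the local case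
analysis (4.12)–(4.14) of the proof of **Proposition 4.6** behind it.  This file is the concatenation
of three parts, each PROVED, with Weil's bound for the three-pole local sums (Lemma 4.2 = Weil 1948 /
Perelmuter 1969 for the family `e_p(a₁/(n+k₁) + a₂/(n+k₂) + tn)`) carried as the explicit hypothesis
`hW` with its constant `C` (no named fact is introduced):

**Part A (local bound at a prime).**
We PROVE the case analysis that feeds `Polymath8a.norm_twoPhase_twisted_le_prod`
(`FractionPhasesProduct.lean`): for a prime `p`, arbitrary unit multipliers `w₁, w₂, w` and any
`C ≥ 3`,
`|∑_{j mod p} [p∣d₁] e_p(c₁/(w₁(j+l₁))) [p∣d₂] e_p(c₂/(w₂(j+l₂))) e_p(jh/w)| ≤ C √p · (√p if p ∣ h, else 1)`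
(`Polymath8a.norm_local_twoPhase_le`), PROVIDED the one genuinely three-pole case — `p ∣ d₁`,
`p ∣ d₂`, `p ∤ c₁c₂`, `l₁ ≢ l₂ (p)`, `p ∤ h` — is granted as an explicit hypothesis `hW` of the theorem
(the statement of Lemma 4.2 = Weil 1948 / Perelmuter 1969 for this family, with constant `C`; it is NOT
proved here and NOT vendored as a fact).  All other cases are unconditional: Ramanujan sums, Kloosterman sums (Weil's
bound (4.8), PROVED in the tree), the Möbius reduction of the untwisted two-pole sum, merging poles, and
the trivial bound.  The factor `√p` at the primes `p ∣ h` is the pessimistic form of the cases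
"`p ∣ f'`" (local sum `p − 1`); it only costs a divisor-type factor `∑_{h ≤ H} (h, q)^{1/2} ≪ τ(q) H`
downstream.

**Part B (Corollary 4.16, `d = 1`).**
* `Polymath8a.norm_twistedSum_twoPhase_le` — for `h ∈ ℤ`, the twisted complete sums obey
  `|∑_{j mod q} e_{d₁}(c₁/(j+l₁)) e_{d₂}(c₂/(j+l₂)) e(jh/q)| ≤ C^{ω(q)} q^{1/2} (h, q)`, `q = [d₁,d₂]`;
* `Polymath8a.corollary_4_16_one` — **Corollary 4.16, second bound, `d = 1`**: for a smooth compactly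
  supported `ψ`, `M > 0`, `x₀`, `H ≥ 1`, `n ≥ 2`, `C ≥ 3` and `hW`,
  `|∑_k ψ((k−x₀)/M) e_{d₁}(c₁/(k+l₁)) e_{d₂}(c₂/(k+l₂))|`
  `≤ (|M'|/q) (c₁,δ₁)(c₂,δ₂)(d₁,d₂) + (M/q)(∫|ψ|) C^{ω(q)} q^{1/2} 2τ(q) H + q · 2(∫|ψ^{(n)}|)(q/(2πM))^n (M/q) H^{1−n}`
  (`M' = ∑_m ψ((m−x₀)/M)`; with `H = qM^{−1+ε}` and `(n−1)ε ≥ A` this is the printed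
  `≪ q^{ε}(q^{1/2} + N(c₁,δ₁)(c₂,δ₂)/(δ₁δ₂))`, since `(d₁,d₂)/q = 1/(δ₁δ₂)`).

**Part C (Corollary 4.16 along a progression `n ≡ t (mod d)`).**
We PROVE the substitution step: along `n = n'd + t` each phase `e_{d_i}(c_i/(n + l_i))` is a constant
of modulus `≤ 1` (its part at the primes of `g_i = (d, d_i)`) times a one-pole phase in `n'` to the
modulus `e_i = d_i/g_i` with the SAME `gcd` invariants (`eFrac_comp_progression`), so that the weighted
sum over the progression is, up to that constant, a `d = 1` sum at scale `M/d` for the moduli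
`e₁, e₂` (`tsum_progression_twoPhase_eq`), to which `corollary_4_16_one` applies
(`corollary_4_16_progression`).  The three-pole Weil bound (Lemma 4.2) remains the explicit hypothesis
`hW`; no named fact is introduced.

## References

* D. H. J. Polymath, arXiv:1402.0811: Lemma 4.2, Proposition 4.6 and its proof ((4.12)–(4.14)),
  Proposition 4.12 (i), Lemma 4.8, Lemma 4.9, Lemma 1.4, Corollary 4.16 and its proof (including the
  last paragraph, the substitution `n = n'd + a`), Proposition 5.10 (use).
  [cite: Polymath8a2014, Corollary 4.16]
* A. Weil, *On some exponential sums*, Proc. Nat. Acad. Sci. USA 34 (1948) 204–207 (Kloosterman case: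
  the tree's PROVED `weil_kloosterman_bound_prime`).
-/

noncomputable section


open Finset Real
open scoped FourierTransform

namespace Literature.NumberTheory.Sieve

namespace Polymath8a

section Local

variable {p : ℕ} [hp : Fact p.Prime]

omit hp in
/-- The trivial bound: `p` terms of modulus `≤ 1`. [folklore] -/
theorem norm_sum_range_le_of_norm_le_one {F : ℕ → ℂ} (hF : ∀ j, ‖F j‖ ≤ 1) :
    ‖∑ j ∈ Finset.range p, F j‖ ≤ p := by
  refine (norm_sum_le _ _).trans ?_
  calc ∑ j ∈ Finset.range p, ‖F j‖ ≤ ∑ j ∈ Finset.range p, (1 : ℝ) := Finset.sum_le_sum fun j _ => hF j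
    _ = p := by simp

/-- An inverse modulo `p` from `IsCoprime`: `w v ≡ 1 (mod p)` with `v` coprime to `p`. [folklore] -/
theorem exists_inverse_of_isCoprime {w : ℤ} (hw : IsCoprime w p) :
    ∃ v : ℤ, (w : ZMod p) * (v : ZMod p) = 1 ∧ IsCoprime v p := by
  obtain ⟨a, b, hab⟩ := hw
  refine ⟨a, ?_, ⟨w, b, by linarith [hab]⟩⟩
  have h := congrArg (fun z : ℤ => (z : ZMod p)) hab
  push_cast at h
  rw [ZMod.natCast_self, mul_zero, add_zero] at h
  rw [mul_comm]; exact h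

/-- The complete sum of the bare twist: `∑_{j mod p} e_p(jt) = p · 1_{p ∣ t}` (orthogonality).
[folklore] -/
theorem sum_range_stdAddChar_mul (t : ℤ) :
    ∑ j ∈ Finset.range p, (ZMod.stdAddChar ((j * t : ℤ) : ZMod p) : ℂ) =
      if (p : ℤ) ∣ t then (p : ℂ) else 0 := by
  classical
  haveI : NeZero p := ⟨hp.out.ne_zero⟩
  have h := AddChar.sum_mulShift (ψ := ZMod.stdAddChar (N := p)) (t : ZMod p)
    (ZMod.isPrimitive_stdAddChar p)
  rw [ZMod.card, Literature.NumberTheory.LFunctions.sum_zmod_eq_sum_range] at h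
  have hL : ∑ j ∈ Finset.range p, (ZMod.stdAddChar ((j * t : ℤ) : ZMod p) : ℂ) =
      ∑ n ∈ Finset.range p, (ZMod.stdAddChar ((n : ZMod p) * (t : ZMod p)) : ℂ) :=
    Finset.sum_congr rfl fun j _ => by push_cast; rfl
  rw [hL, h]
  by_cases htt : (p : ℤ) ∣ t
  · rw [if_pos htt, if_pos ((ZMod.intCast_zmod_eq_zero_iff_dvd t p).mpr htt)]
  · rw [if_neg htt, if_neg (fun h0 => htt ((ZMod.intCast_zmod_eq_zero_iff_dvd t p).mp h0))]
    push_cast; rfl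

/-- **The local bound at a prime for the twisted two-phase sums** (the case analysis (4.12)–(4.14)
of the proof of Proposition 4.6, for `f(n) = c₁/(n+l₁) + c₂/(n+l₂) + hn`): for a prime `p`, unit
multipliers `w₁, w₂, w`, and `C ≥ 3`,
`|∑_{j mod p} [p∣d₁] e_p(c₁/(w₁(j+l₁))) [p∣d₂] e_p(c₂/(w₂(j+l₂))) e_p(jh/w)| ≤ C √p (√p if p ∣ h else 1)`,
granted, as the hypothesis `hW`, Weil's bound (Lemma 4.2) in the one case with three genuine poles
(`p ∣ d₁`, `p ∣ d₂`, `p ∤ c₁c₂` after unit changes, `l₁ ≢ l₂ (p)`, `p ∤ h`): all other cases are Ramanujan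
sums, Kloosterman sums (Weil's (4.8), proved in the tree), the Möbius reduction of the untwisted two-pole
sum, merged poles, or the trivial bound `p` (which only occurs when `p ∣ h`).
[cite: Polymath8a2014, Proposition 4.6, proof ((4.12)–(4.14)), Lemma 4.2] -/
theorem norm_local_twoPhase_le {C : ℝ} (hC : 3 ≤ C) (d₁ d₂ : ℕ)
    (hW : p ∣ d₁ → p ∣ d₂ → ∀ (a₁ a₂ k₁ k₂ t : ℤ), ¬ (p : ℤ) ∣ a₁ → ¬ (p : ℤ) ∣ a₂ →
      ¬ (p : ℤ) ∣ k₂ - k₁ → ¬ (p : ℤ) ∣ t →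
      ‖∑ j ∈ Finset.range p, eFrac p a₁ (j + k₁) * eFrac p a₂ (j + k₂) *
        (ZMod.stdAddChar ((j * t : ℤ) : ZMod p) : ℂ)‖ ≤ C * Real.sqrt p)
    (c₁ c₂ l₁ l₂ h : ℤ) {w₁ w₂ w : ℤ} (hw₁ : IsCoprime w₁ p) (hw₂ : IsCoprime w₂ p)
    (hw : IsCoprime w p) :
    ‖∑ j ∈ Finset.range p, (if p ∣ d₁ then eFrac p c₁ (w₁ * (j + l₁)) else 1) *
        (if p ∣ d₂ then eFrac p c₂ (w₂ * (j + l₂)) else 1) * eFrac p (j * h) w‖ ≤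
      C * Real.sqrt p * (if (p : ℤ) ∣ h then Real.sqrt p else 1) := by
  classical
  haveI : NeZero p := ⟨hp.out.ne_zero⟩
  -- sizes
  have hp1 : (1 : ℝ) ≤ Real.sqrt p := by
    rw [Real.one_le_sqrt]; exact_mod_cast hp.out.one_lt.le
  have hpp : (p : ℝ) = Real.sqrt p * Real.sqrt p := (Real.mul_self_sqrt (Nat.cast_nonneg p)).symm
  have hC0 : 0 ≤ C := by linarith
  have hfac : (1 : ℝ) ≤ (if (p : ℤ) ∣ h then Real.sqrt p else 1) := by split_ifs <;> linarith
  have hCp : C * Real.sqrt p ≤ C * Real.sqrt p * (if (p : ℤ) ∣ h then Real.sqrt p else 1) :=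
    le_mul_of_one_le_right (by positivity) hfac
  -- `2√p`, `2√p + 1` and (when `p ∣ h`) `p` are all below the bound
  have h2 : 2 * Real.sqrt p ≤ C * Real.sqrt p * (if (p : ℤ) ∣ h then Real.sqrt p else 1) :=
    le_trans (by nlinarith) hCp
  have h3 : 2 * Real.sqrt p + 1 ≤ C * Real.sqrt p * (if (p : ℤ) ∣ h then Real.sqrt p else 1) :=
    le_trans (by nlinarith) hCp
  have hP : (p : ℤ) ∣ h → (p : ℝ) ≤ C * Real.sqrt p * (if (p : ℤ) ∣ h then Real.sqrt p else 1) := by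
    intro hh
    rw [if_pos hh]
    have h1 : (1 : ℝ) * (Real.sqrt p * Real.sqrt p) ≤ C * (Real.sqrt p * Real.sqrt p) :=
      mul_le_mul_of_nonneg_right (by linarith) (by positivity)
    calc (p : ℝ) = Real.sqrt p * Real.sqrt p := hpp
      _ ≤ C * Real.sqrt p * Real.sqrt p := by linarith
  -- normalise the unit multipliers: inverses `v₁, v₂, v`
  obtain ⟨v₁, hv₁, hv₁c⟩ := exists_inverse_of_isCoprime hw₁
  obtain ⟨v₂, hv₂, hv₂c⟩ := exists_inverse_of_isCoprime hw₂
  obtain ⟨v, hv, hvc⟩ := exists_inverse_of_isCoprime hw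
  have htw : ∀ j : ℕ, eFrac p ((j : ℤ) * h) w = (ZMod.stdAddChar (((j : ℤ) * (h * v) : ℤ) : ZMod p) : ℂ) := by
    intro j
    rw [show (w : ℤ) = w * 1 by ring, eFrac_unit_mul hv, eFrac_of_isUnit (by push_cast; exact isUnit_one)]
    congr 1; push_cast
    rw [show ((1 : ZMod p))⁻¹ = 1 from by
      simpa only [one_mul] using ZMod.mul_inv_of_unit (1 : ZMod p) isUnit_one]
    ring
  have hph₁ : ∀ j : ℕ, eFrac p c₁ (w₁ * (j + l₁)) = eFrac p (c₁ * v₁) (j + l₁) := fun j => eFrac_unit_mul hv₁ _ _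
  have hph₂ : ∀ j : ℕ, eFrac p c₂ (w₂ * (j + l₂)) = eFrac p (c₂ * v₂) (j + l₂) := fun j => eFrac_unit_mul hv₂ _ _
  simp_rw [htw, hph₁, hph₂]
  -- divisibility of the normalised parameters
  set a₁ : ℤ := c₁ * v₁ with ha₁
  set a₂ : ℤ := c₂ * v₂ with ha₂
  set t : ℤ := h * v with ht
  have hunit_dvd : ∀ {x u : ℤ}, IsCoprime u p → ((p : ℤ) ∣ x * u ↔ (p : ℤ) ∣ x) := fun {x u} hu =>
    ⟨fun hh => IsCoprime.dvd_of_dvd_mul_right hu.symm hh, fun hh => hh.mul_right u⟩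
  have hdvt : (p : ℤ) ∣ t ↔ (p : ℤ) ∣ h := hunit_dvd hvc
  -- norms of the explicit values
  have hnorm_p1 : ‖(p : ℂ) - 1‖ ≤ p := by
    rw [show (p : ℂ) - 1 = ((p - 1 : ℕ) : ℂ) by push_cast [Nat.cast_sub hp.out.one_le]; ring,
      Complex.norm_natCast]
    exact_mod_cast Nat.sub_le p 1
  have htriv : ∀ (F : ℕ → ℂ), (∀ j, ‖F j‖ ≤ 1) → (p : ℤ) ∣ h →
      ‖∑ j ∈ Finset.range p, F j‖ ≤ C * Real.sqrt p * (if (p : ℤ) ∣ h then Real.sqrt p else 1) :=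
    fun F hF hh => (norm_sum_range_le_of_norm_le_one hF).trans (hP hh)
  have hone : ∀ j : ℕ, ‖(ZMod.stdAddChar (((j : ℤ) * t : ℤ) : ZMod p) : ℂ)‖ = 1 := fun j => norm_stdAddChar _
  -- untwisting when `p ∣ t`
  have huntwist : (p : ℤ) ∣ t → ∀ j : ℕ, (ZMod.stdAddChar (((j : ℤ) * t : ℤ) : ZMod p) : ℂ) = 1 := by
    intro htt j
    rw [show (((j : ℤ) * t : ℤ) : ZMod p) = 0 by
      push_cast; rw [(ZMod.intCast_zmod_eq_zero_iff_dvd t p).mpr htt, mul_zero], AddChar.map_zero_eq_one]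
  -- the one-pole case, used three times
  have honePole : ∀ (a l : ℤ), ‖∑ j ∈ Finset.range p, eFrac p a (j + l) *
      (ZMod.stdAddChar (((j : ℤ) * t : ℤ) : ZMod p) : ℂ)‖ ≤
        C * Real.sqrt p * (if (p : ℤ) ∣ h then Real.sqrt p else 1) := by
    intro a l
    by_cases hx : (p : ℤ) ∣ a ∧ (p : ℤ) ∣ t
    · rw [sum_range_eFrac_add_mul_twist_of_dvd hx.1 hx.2]
      exact hnorm_p1.trans (hP (hdvt.mp hx.2))
    · exact (norm_sum_range_eFrac_add_mul_twist_le a l t hx).trans h2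
  by_cases hd₁ : p ∣ d₁ <;> by_cases hd₂ : p ∣ d₂ <;>
    simp only [hd₁, hd₂, if_true, if_false, one_mul, mul_one]
  · -- both phases present
    by_cases hA₁ : (p : ℤ) ∣ a₁
    · by_cases hx : (p : ℤ) ∣ a₂ ∧ (p : ℤ) ∣ t
      · refine htriv _ (fun j => ?_) (hdvt.mp hx.2)
        rw [norm_mul, norm_mul, hone, mul_one]
        exact mul_le_one₀ (norm_eFrac_le_one _ _) (norm_nonneg _) (norm_eFrac_le_one _ _)
      · exact (norm_sum_range_eFrac_mul_eFrac_mul_twist_le_of_dvd hA₁ hx l₁ l₂).trans h3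
    · by_cases hA₂ : (p : ℤ) ∣ a₂
      · have hcomm : ∑ j ∈ Finset.range p, eFrac p a₁ (j + l₁) * eFrac p a₂ (j + l₂) *
            (ZMod.stdAddChar (((j : ℤ) * t : ℤ) : ZMod p) : ℂ) =
            ∑ j ∈ Finset.range p, eFrac p a₂ (j + l₂) * eFrac p a₁ (j + l₁) *
              (ZMod.stdAddChar (((j : ℤ) * t : ℤ) : ZMod p) : ℂ) :=
          Finset.sum_congr rfl fun j _ => by ring
        rw [hcomm]
        exact (norm_sum_range_eFrac_mul_eFrac_mul_twist_le_of_dvd hA₂ (fun hx => hA₁ hx.1) l₂ l₁).trans h3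
      · by_cases hl : (p : ℤ) ∣ l₂ - l₁
        · -- merging poles
          have hmerge : ∀ j : ℕ, eFrac p a₁ (j + l₁) * eFrac p a₂ (j + l₂) = eFrac p (a₁ + a₂) (j + l₁) := by
            intro j
            rw [eFrac_congr_right a₂ (m' := (j : ℤ) + l₁) (by
              obtain ⟨k, hk⟩ := hl
              rw [show (j : ℤ) + l₂ = (j + l₁) + p * k by linarith]
              push_cast; rw [ZMod.natCast_self, zero_mul, add_zero]), eFrac_mul_eFrac_same]
          simp_rw [hmerge]
          exact honePole _ _
        · by_cases htt : (p : ℤ) ∣ t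
          · -- no twist: the Möbius reduction
            simp_rw [huntwist htt, mul_one]
            exact (norm_sum_range_eFrac_mul_eFrac_le_of_prime hA₁ hA₂ hl).trans h3
          · -- three genuine poles: the hypothesis
            exact (hW hd₁ hd₂ a₁ a₂ l₁ l₂ t hA₁ hA₂ hl htt).trans hCp
  · -- only the first phase
    exact honePole _ _
  · -- only the second phase
    exact honePole _ _
  · -- the bare twist
    rw [sum_range_stdAddChar_mul]
    by_cases htt : (p : ℤ) ∣ t
    · rw [if_pos htt, Complex.norm_natCast]; exact hP (hdvt.mp htt)
    · rw [if_neg htt, norm_zero]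
      exact le_trans (by positivity : (0 : ℝ) ≤ 2 * Real.sqrt p) h2

end Local

end Polymath8a

end Literature.NumberTheory.Sieve



open Finset Real MeasureTheory
open scoped FourierTransform ContDiff

namespace Literature.NumberTheory.Sieve

namespace Polymath8a

open Literature.NumberTheory.LFunctions.MatomakiMerikoski (MatomakiMerikoski2023_lemma37_i)

/-! ### Arithmetic of the product of local bounds -/

/-- `∏_{p ∈ s} (m, p) = (m, ∏_{p ∈ s} p)` for a finite set `s` of primes. [folklore] -/
theorem prod_gcd_eq_gcd_prod {s : Finset ℕ} (hs : ∀ p ∈ s, p.Prime) (m : ℕ) :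
    ∏ p ∈ s, Nat.gcd m p = Nat.gcd m (∏ p ∈ s, p) := by
  classical
  induction s using Finset.induction_on with
  | empty => simp
  | insert p s hps ih =>
    have hp : p.Prime := hs p (Finset.mem_insert_self p s)
    have hs' : ∀ p' ∈ s, p'.Prime := fun p' hp' => hs p' (Finset.mem_insert_of_mem hp')
    have hcop : p.Coprime (∏ p' ∈ s, p') := by
      refine Nat.Coprime.prod_right fun p' hp' => (Nat.coprime_primes hp (hs' p' hp')).mpr ?_
      rintro rfl; exact hps hp'
    rw [Finset.prod_insert hps, Finset.prod_insert hps, ih hs', Nat.Coprime.gcd_mul m hcop]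

/-- For squarefree `q`: `∏_{p ∣ q} (h, p) = (h, q)`. [folklore] -/
theorem prod_primeFactors_int_gcd {q : ℕ} (hq : Squarefree q) (h : ℤ) :
    ∏ p ∈ q.primeFactors, (Int.gcd h p : ℝ) = Int.gcd h q := by
  have h1 : ∀ p : ℕ, Int.gcd h p = Nat.gcd h.natAbs p := fun p => by
    rw [Int.gcd_eq_natAbs, Int.natAbs_natCast]
  simp_rw [h1]
  rw [← Nat.cast_prod, prod_gcd_eq_gcd_prod (fun p hp => Nat.prime_of_mem_primeFactors hp),
    Nat.prod_primeFactors_of_squarefree hq]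

/-- For squarefree `q`: `∏_{p ∣ q} √p = √q`. [folklore] -/
theorem prod_primeFactors_sqrt {q : ℕ} (hq : Squarefree q) :
    ∏ p ∈ q.primeFactors, Real.sqrt p = Real.sqrt q := by
  have h0 : 0 ≤ ∏ p ∈ q.primeFactors, Real.sqrt p := Finset.prod_nonneg fun _ _ => Real.sqrt_nonneg _
  rw [← Real.sqrt_sq h0, ← Finset.prod_pow]
  congr 1
  rw [Finset.prod_congr rfl fun p _ => Real.sq_sqrt (Nat.cast_nonneg p), ← Nat.cast_prod,
    Nat.prod_primeFactors_of_squarefree hq]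

/-- The local factor is at most the local gcd: `(√p if p ∣ h else 1) ≤ (h, p)`. [folklore] -/
theorem ite_sqrt_le_gcd {p : ℕ} (hp : p.Prime) (h : ℤ) :
    (if (p : ℤ) ∣ h then Real.sqrt p else 1) ≤ (Int.gcd h p : ℝ) := by
  split_ifs with hh
  · have hg : Int.gcd h p = p := by
      rw [Int.gcd_eq_natAbs, Int.natAbs_natCast]
      exact Nat.gcd_eq_right (Int.natCast_dvd.mp hh)
    rw [hg]
    have h1 : (1 : ℝ) ≤ p := by exact_mod_cast hp.one_lt.le
    rw [Real.sqrt_le_left (by linarith)]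
    nlinarith
  · have : 1 ≤ Int.gcd h p := Nat.pos_of_ne_zero (by
      rw [Ne, Int.gcd_eq_zero_iff]; exact fun hh' => hp.ne_zero (by exact_mod_cast hh'.2))
    exact_mod_cast this

/-- **The product of the local bounds**: for squarefree `q` and `C ≥ 0`,
`∏_{p ∣ q} C √p (√p if p ∣ h else 1) ≤ C^{ω(q)} √q (h, q)`. [folklore] -/
theorem prod_localBound_le {q : ℕ} (hq : Squarefree q) {C : ℝ} (hC : 0 ≤ C) (h : ℤ) :
    ∏ p ∈ q.primeFactors, (C * Real.sqrt p * (if (p : ℤ) ∣ h then Real.sqrt p else 1)) ≤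
      C ^ q.primeFactors.card * Real.sqrt q * Int.gcd h q := by
  rw [Finset.prod_mul_distrib, Finset.prod_mul_distrib, Finset.prod_const, prod_primeFactors_sqrt hq,
    ← prod_primeFactors_int_gcd hq h]
  refine mul_le_mul_of_nonneg_left (Finset.prod_le_prod (fun p _ => by positivity)
    fun p hp => ite_sqrt_le_gcd (Nat.prime_of_mem_primeFactors hp) h) (by positivity)

/-- The `lcm` of two squarefree numbers is squarefree. [folklore] -/
theorem squarefree_lcm {a b : ℕ} (ha : Squarefree a) (hb : Squarefree b) : Squarefree (a.lcm b) := by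
  have ha0 : a ≠ 0 := ha.ne_zero
  have hb0 : b ≠ 0 := hb.ne_zero
  have hl0 : a.lcm b ≠ 0 := Nat.lcm_ne_zero ha0 hb0
  rw [Nat.squarefree_iff_factorization_le_one hl0]
  intro p
  rw [Nat.factorization_lcm ha0 hb0, Finsupp.sup_apply]
  exact sup_le ((Nat.squarefree_iff_factorization_le_one ha0).mp ha p)
    ((Nat.squarefree_iff_factorization_le_one hb0).mp hb p)

/-! ### The twisted complete sums -/

/-- **The twisted complete sums of Corollary 4.16** (Proposition 4.6 for
`f(n) = c₁/(n+l₁) + c₂/(n+l₂) + hn/q`): for squarefree `d₁, d₂`, `q = [d₁,d₂]`, `C ≥ 3` and the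
three-pole Weil hypothesis `hW`,
`|∑_{j mod q} e_{d₁}(c₁/(j+l₁)) e_{d₂}(c₂/(j+l₂)) e(jh/q)| ≤ C^{ω(q)} q^{1/2} (h, q)`.
[cite: Polymath8a2014, Proposition 4.6 and Corollary 4.16, proof] -/
theorem norm_twistedSum_twoPhase_le {d₁ d₂ q : ℕ} [NeZero d₁] [NeZero d₂] [NeZero q]
    (hd₁ : Squarefree d₁) (hd₂ : Squarefree d₂) (hq : Nat.lcm d₁ d₂ = q) (c₁ c₂ l₁ l₂ : ℤ)
    {C : ℝ} (hC : 3 ≤ C)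
    (hW : ∀ p : ℕ, (hp : p.Prime) → p ∣ d₁ → p ∣ d₂ → ∀ (a₁ a₂ k₁ k₂ t : ℤ),
      ¬ (p : ℤ) ∣ a₁ → ¬ (p : ℤ) ∣ a₂ → ¬ (p : ℤ) ∣ k₂ - k₁ → ¬ (p : ℤ) ∣ t →
      (haveI : NeZero p := ⟨hp.ne_zero⟩;
        ‖∑ j ∈ Finset.range p, eFrac p a₁ (j + k₁) * eFrac p a₂ (j + k₂) *
          (ZMod.stdAddChar ((j * t : ℤ) : ZMod p) : ℂ)‖ ≤ C * Real.sqrt p))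
    (h : ℤ) :
    ‖∑ j ∈ Finset.range q, eFrac d₁ c₁ (j + l₁) * eFrac d₂ c₂ (j + l₂) * (𝐞 ((j : ℝ) * h / q) : ℂ)‖ ≤
      C ^ q.primeFactors.card * Real.sqrt q * Int.gcd h q := by
  have hqsf : Squarefree q := hq ▸ squarefree_lcm hd₁ hd₂
  have hC0 : 0 ≤ C := by linarith
  -- rewrite the summand in the shape of `norm_twoPhase_twisted_le_prod`
  have hre : ∑ j ∈ Finset.range q, eFrac d₁ c₁ (j + l₁) * eFrac d₂ c₂ (j + l₂) * (𝐞 ((j : ℝ) * h / q) : ℂ) =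
      ∑ j ∈ Finset.range q, eFrac d₁ c₁ (1 * (j + l₁)) * eFrac d₂ c₂ (1 * (j + l₂)) * eFrac q (j * h) 1 := by
    refine Finset.sum_congr rfl fun j _ => ?_
    rw [one_mul, one_mul, ← Int.cast_natCast (R := ℝ) j, fourierChar_eq_eFrac_one]
  rw [hre]
  have hprod := norm_twoPhase_twisted_le_prod q d₁ d₂ hd₁ hd₂ hq c₁ c₂ l₁ l₂ 1 1 h 1
    isCoprime_one_left isCoprime_one_left isCoprime_one_left
    (fun p => C * Real.sqrt p * (if (p : ℤ) ∣ h then Real.sqrt p else 1))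
    (fun p hp _ w₁ w₂ w hw₁ hw₂ hw => by
      haveI := Fact.mk hp
      exact norm_local_twoPhase_le hC d₁ d₂ (hW p hp) c₁ c₂ l₁ l₂ h hw₁ hw₂ hw)
  exact hprod.trans (prod_localBound_le hqsf hC0 h)

/-! ### Corollary 4.16 (second bound), `d = 1` -/

/-- The sum of the gcd factors over the truncated dual range:
`∑_{|h| ≤ H, q ∤ h} (h, q) ≤ 2 τ(q) H`. [cite: Polymath8a2014, Lemma 1.4] -/
theorem sum_filter_gcd_le {q : ℕ} (hq : q ≠ 0) (H : ℕ) :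
    ∑ h ∈ (Finset.Icc (-(H : ℤ)) H).filter (fun h => ¬ (q : ℤ) ∣ h), (Int.gcd h q : ℝ) ≤
      2 * q.divisors.card * H := by
  calc ∑ h ∈ (Finset.Icc (-(H : ℤ)) H).filter (fun h => ¬ (q : ℤ) ∣ h), (Int.gcd h q : ℝ)
      = ∑ h ∈ Finset.Icc (-(H : ℤ)) H, (if ¬ (q : ℤ) ∣ h then (Int.gcd h q : ℝ) else 0) :=
        Finset.sum_filter _ _
    _ = (if ¬ (q : ℤ) ∣ (0 : ℤ) then (Int.gcd 0 q : ℝ) else 0) +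
          ∑ ν ∈ Finset.Icc 1 H, ((if ¬ (q : ℤ) ∣ (ν : ℤ) then (Int.gcd (ν : ℤ) q : ℝ) else 0) +
            (if ¬ (q : ℤ) ∣ (-(ν : ℤ)) then (Int.gcd (-(ν : ℤ)) q : ℝ) else 0)) :=
        sum_Icc_neg_eq _ H
    _ ≤ 0 + ∑ ν ∈ Finset.Icc 1 H, 2 * (Nat.gcd ν q : ℝ) := by
        refine add_le_add (by rw [if_neg (not_not.mpr (dvd_zero _))]) (Finset.sum_le_sum fun ν _ => ?_)
        have hg : Int.gcd (ν : ℤ) q = Nat.gcd ν q := by rw [Int.gcd_natCast_natCast]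
        have hg' : Int.gcd (-(ν : ℤ)) q = Nat.gcd ν q := by
          rw [Int.gcd_eq_natAbs, Int.natAbs_neg, Int.natAbs_natCast, Int.natAbs_natCast]
        have h0 : (0 : ℝ) ≤ Nat.gcd ν q := Nat.cast_nonneg _
        rw [hg, hg']
        split_ifs <;> linarith
    _ = 2 * ∑ ν ∈ Finset.Icc 1 H, (Nat.gcd ν q : ℝ) := by rw [zero_add, Finset.mul_sum]
    _ ≤ 2 * (q.divisors.card * H) := by
        refine mul_le_mul_of_nonneg_left ?_ (by norm_num)
        exact_mod_cast MatomakiMerikoski2023_lemma37_i hq H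
    _ = _ := by ring

/-- **Polymath 8a, Corollary 4.16, second bound (`d = 1`)**: "Let `d₁, d₂` be squarefree integers, not
necessarily coprime … `|∑_n ψ_N(n) e_{d₁}(c₁/(n+l₁)) e_{d₂}(c₂/(n+l₂))| ≪ [d₁,d₂]^ε ([d₁,d₂]^{1/2} +
N (c₁,δ₁)(c₂,δ₂)/(δ₁δ₂))`", here with explicit constants, for `ψ_N(n) = ψ((n − x₀)/M)`, an arbitrary
truncation `H ≥ 1` of the dual sum and `n ≥ 2` integrations by parts, and with Weil's bound for the
three-pole local sums (Lemma 4.2) as the hypothesis `hW` (constant `C ≥ 3`):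
`|∑_k ψ((k−x₀)/M) e_{d₁}(c₁/(k+l₁)) e_{d₂}(c₂/(k+l₂))| ≤ (|M'|/q)(c₁,δ₁)(c₂,δ₂)(d₁,d₂)`
`+ (M/q)(∫|ψ|) C^{ω(q)} √q · 2τ(q)H + q · 2(∫|ψ^{(n)}|)(q/(2πM))^n (M/q) H^{1−n}`, `q = [d₁,d₂]`,
`M' = ∑_m ψ((m−x₀)/M)`.  Proof as printed: completion of sums (Lemma 4.9, `completion_truncated`), Lemma 4.8
for the zero frequency, Proposition 4.6 (`norm_twistedSum_twoPhase_le`) for the others, and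
`∑_{h≤H}(h,q) ≤ τ(q)H` (Lemma 1.4). [cite: Polymath8a2014, Corollary 4.16] -/
theorem corollary_4_16_one {ψ : ℝ → ℂ} (hψ : ContDiff ℝ ∞ ψ) (hψc : HasCompactSupport ψ) {M : ℝ}
    (hM : 0 < M) (x₀ : ℝ) {d₁ d₂ q : ℕ} [NeZero d₁] [NeZero d₂] [NeZero q] (hd₁ : Squarefree d₁)
    (hd₂ : Squarefree d₂) (hq : Nat.lcm d₁ d₂ = q) (c₁ c₂ l₁ l₂ : ℤ) {H : ℕ} (hH : 1 ≤ H) {n : ℕ}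
    (hn : 2 ≤ n) {C : ℝ} (hC : 3 ≤ C)
    (hW : ∀ p : ℕ, (hp : p.Prime) → p ∣ d₁ → p ∣ d₂ → ∀ (a₁ a₂ k₁ k₂ t : ℤ),
      ¬ (p : ℤ) ∣ a₁ → ¬ (p : ℤ) ∣ a₂ → ¬ (p : ℤ) ∣ k₂ - k₁ → ¬ (p : ℤ) ∣ t →
      (haveI : NeZero p := ⟨hp.ne_zero⟩;
        ‖∑ j ∈ Finset.range p, eFrac p a₁ (j + k₁) * eFrac p a₂ (j + k₂) *
          (ZMod.stdAddChar ((j * t : ℤ) : ZMod p) : ℂ)‖ ≤ C * Real.sqrt p)) :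
    ‖∑' k : ℤ, ψ ((k - x₀) / M) * (eFrac d₁ c₁ (k + l₁) * eFrac d₂ c₂ (k + l₂))‖ ≤
      ‖∑' m : ℤ, ψ ((m - x₀) / M)‖ / q *
          (Int.gcd c₁ (d₁ / Nat.gcd d₁ d₂ : ℕ) * Int.gcd c₂ (d₂ / Nat.gcd d₁ d₂ : ℕ) * Nat.gcd d₁ d₂) +
      M / q * (∫ t, ‖ψ t‖) * (C ^ q.primeFactors.card * Real.sqrt q * (2 * q.divisors.card * H)) +
      q * (2 * (∫ t, ‖iteratedDeriv n ψ t‖) * ((q : ℝ) / (2 * π * M)) ^ n * (M / q) *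
        ((H : ℝ) ^ (n - 1))⁻¹) := by
  have hq0 : q ≠ 0 := NeZero.ne q
  have hqpos : 0 < q := Nat.pos_of_ne_zero hq0
  set G : ℤ → ℂ := fun m => eFrac d₁ c₁ (m + l₁) * eFrac d₂ c₂ (m + l₂) with hG
  have hGper : ∀ m k : ℤ, G (m + q * k) = G m := by
    intro m k
    simp only [hG]
    have h1 : (d₁ : ℤ) ∣ (q : ℤ) * k := Dvd.dvd.mul_right (Int.natCast_dvd_natCast.mpr (hq ▸ Nat.dvd_lcm_left d₁ d₂)) k
    have h2 : (d₂ : ℤ) ∣ (q : ℤ) * k := Dvd.dvd.mul_right (Int.natCast_dvd_natCast.mpr (hq ▸ Nat.dvd_lcm_right d₁ d₂)) k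
    rw [show m + q * k + l₁ = (m + l₁) + q * k by ring, show m + q * k + l₂ = (m + l₂) + q * k by ring]
    obtain ⟨k₁, hk₁⟩ := h1
    obtain ⟨k₂, hk₂⟩ := h2
    congr 1
    · rw [hk₁, eFrac_add_mul_self]
    · rw [hk₂, eFrac_add_mul_self]
  have hGle : ∀ m : ℤ, ‖G m‖ ≤ 1 := fun m => by
    simp only [hG]; rw [norm_mul]
    exact mul_le_one₀ (norm_eFrac_le_one _ _) (norm_nonneg _) (norm_eFrac_le_one _ _)
  -- completion of sums along `ℤ` (`d = 1`, `b = 0`)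
  have hcomp := completion_truncated hψ hψc hM x₀ Nat.one_pos hqpos 0 hGper hH hn
  simp only [one_mul, zero_add, Nat.cast_one, Int.cast_zero, Int.cast_natCast] at hcomp
  -- the main term (Lemma 4.8)
  have hmain : ‖∑ j ∈ Finset.range q, G j‖ ≤
      Int.gcd c₁ (d₁ / Nat.gcd d₁ d₂ : ℕ) * Int.gcd c₂ (d₂ / Nat.gcd d₁ d₂ : ℕ) * Nat.gcd d₁ d₂ := by
    have h48 := norm_sum_eFrac_mul_eFrac_le hd₁ hd₂ c₁ c₂ l₁ l₂
    rwa [hq] at h48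
  -- the dual terms (Proposition 4.6) and their sum (Lemma 1.4)
  have hT : ∀ h' : ℤ, ‖∑ j ∈ Finset.range q, G j * (𝐞 ((j : ℝ) * h' / q) : ℂ)‖ ≤
      C ^ q.primeFactors.card * Real.sqrt q * Int.gcd h' q := fun h' =>
    norm_twistedSum_twoPhase_le hd₁ hd₂ hq c₁ c₂ l₁ l₂ hC hW h'
  have hdual : ∑ h' ∈ (Finset.Icc (-(H : ℤ)) H).filter (fun h' => ¬ (q : ℤ) ∣ h'),
      ‖∑ j ∈ Finset.range q, G j * (𝐞 ((j : ℝ) * h' / q) : ℂ)‖ ≤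
      C ^ q.primeFactors.card * Real.sqrt q * (2 * q.divisors.card * H) := by
    calc _ ≤ ∑ h' ∈ (Finset.Icc (-(H : ℤ)) H).filter (fun h' => ¬ (q : ℤ) ∣ h'),
          C ^ q.primeFactors.card * Real.sqrt q * Int.gcd h' q := Finset.sum_le_sum fun h' _ => hT h'
      _ = C ^ q.primeFactors.card * Real.sqrt q *
          ∑ h' ∈ (Finset.Icc (-(H : ℤ)) H).filter (fun h' => ¬ (q : ℤ) ∣ h'), (Int.gcd h' q : ℝ) := by
          rw [Finset.mul_sum]
      _ ≤ _ := mul_le_mul_of_nonneg_left (sum_filter_gcd_le hq0 H)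
          (by have : (0:ℝ) ≤ C := by linarith
              positivity)
  -- the `ℓ¹` mass
  have hmass : ∑ j ∈ Finset.range q, ‖G j‖ ≤ q := by
    calc ∑ j ∈ Finset.range q, ‖G j‖ ≤ ∑ j ∈ Finset.range q, (1 : ℝ) := Finset.sum_le_sum fun j _ => hGle j
      _ = q := by simp
  -- assemble
  have hI0 : 0 ≤ ∫ t, ‖ψ t‖ := integral_nonneg fun _ => norm_nonneg _
  have hIn : 0 ≤ ∫ t, ‖iteratedDeriv n ψ t‖ := integral_nonneg fun _ => norm_nonneg _
  have htail0 : 0 ≤ 2 * (∫ t, ‖iteratedDeriv n ψ t‖) * ((q : ℝ) / (2 * π * M)) ^ n * (M / q) *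
      ((H : ℝ) ^ (n - 1))⁻¹ := by positivity
  calc ‖∑' k : ℤ, ψ ((k - x₀) / M) * G k‖
      ≤ ‖∑' k : ℤ, ψ ((k - x₀) / M) * G k - (∑' m : ℤ, ψ ((m - x₀) / M)) / q * ∑ j ∈ Finset.range q, G j‖ +
        ‖(∑' m : ℤ, ψ ((m - x₀) / M)) / q * ∑ j ∈ Finset.range q, G j‖ := norm_le_norm_sub_add _ _
    _ ≤ (M / q * (∫ t, ‖ψ t‖) * ∑ h' ∈ (Finset.Icc (-(H : ℤ)) H).filter (fun h' => ¬ (q : ℤ) ∣ h'),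
            ‖∑ j ∈ Finset.range q, G j * (𝐞 ((j : ℝ) * h' / q) : ℂ)‖ +
          (∑ j ∈ Finset.range q, ‖G j‖) * (2 * (∫ t, ‖iteratedDeriv n ψ t‖) *
            ((q : ℝ) / (2 * π * M)) ^ n * (M / q) * ((H : ℝ) ^ (n - 1))⁻¹)) +
        ‖∑' m : ℤ, ψ ((m - x₀) / M)‖ / q * ‖∑ j ∈ Finset.range q, G j‖ := by
        refine add_le_add hcomp (le_of_eq ?_)
        rw [norm_mul, norm_div, Complex.norm_natCast]
    _ ≤ (M / q * (∫ t, ‖ψ t‖) * (C ^ q.primeFactors.card * Real.sqrt q * (2 * q.divisors.card * H)) +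
          q * (2 * (∫ t, ‖iteratedDeriv n ψ t‖) * ((q : ℝ) / (2 * π * M)) ^ n * (M / q) *
            ((H : ℝ) ^ (n - 1))⁻¹)) +
        ‖∑' m : ℤ, ψ ((m - x₀) / M)‖ / q *
          (Int.gcd c₁ (d₁ / Nat.gcd d₁ d₂ : ℕ) * Int.gcd c₂ (d₂ / Nat.gcd d₁ d₂ : ℕ) * Nat.gcd d₁ d₂) := by
        refine add_le_add (add_le_add ?_ ?_) ?_
        · exact mul_le_mul_of_nonneg_left hdual (by positivity)
        · exact mul_le_mul_of_nonneg_right hmass htail0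
        · exact mul_le_mul_of_nonneg_left hmain (by positivity)
    _ = _ := by ring

end Polymath8a

end Literature.NumberTheory.Sieve



open Finset Real MeasureTheory
open scoped FourierTransform ContDiff

namespace Literature.NumberTheory.Sieve

namespace Polymath8a

/-! ### The substitution `n = n'd + t` in one phase -/

/-- **One phase along a progression**: let `g e` be squarefree with `(g, e) = 1`, `g ∣ d`, `(d, e) = 1`,
and let `v, w` be inverses `(gd)v ≡ 1`, `dw ≡ 1 (mod e)`.  Then along `n = n'd + t`,
`e_{ge}(c/(n'd + t + l)) = e_g(c/(e(t+l))) · e_e((cv)/(n' + (t+l)w))` — a constant times a one-pole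
phase in `n'` to the modulus `e`. [cite: Polymath8a2014, Corollary 4.16, proof (substitution `n = n'd + a`)] -/
theorem eFrac_comp_progression {g e : ℕ} [NeZero g] [NeZero e] (hge : g.Coprime e) {d : ℕ} (hgd : g ∣ d)
    {v w : ℤ} (hv : ((g * d : ℕ) : ZMod e) * (v : ZMod e) = 1) (hw : (d : ZMod e) * (w : ZMod e) = 1)
    (c t l n' : ℤ) :
    eFrac (g * e) c (d * n' + t + l) = eFrac g c (e * (t + l)) * eFrac e (c * v) (n' + (t + l) * w) := by
  rw [eFrac_mul_of_coprime hge]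
  congr 1
  · refine eFrac_congr_right c ?_
    obtain ⟨k, hk⟩ := hgd
    rw [hk]; push_cast; rw [ZMod.natCast_self]; ring
  · rw [← eFrac_unit_mul (u := ((g * d : ℕ) : ℤ)) (by exact_mod_cast hv)]
    refine eFrac_congr_right c ?_
    have hw' : (d : ZMod e) * (w : ZMod e) = 1 := hw
    push_cast
    linear_combination (-(↑g * (↑t + ↑l)) : ZMod e) * hw'

/-- Changing the name of the modulus (the `NeZero` instances are propositional). [folklore] -/
theorem eFrac_modulus_congr {d d' : ℕ} [NeZero d] [NeZero d'] (h : d = d') (c m : ℤ) :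
    eFrac d c m = eFrac d' c m := by subst h; rfl

/-- An inverse modulo `e` from `IsCoprime`. [folklore] -/
theorem exists_mul_intCast_eq_one {e : ℕ} {u : ℤ} (hu : IsCoprime u e) :
    ∃ v : ℤ, (u : ZMod e) * (v : ZMod e) = 1 ∧ IsCoprime v e := by
  obtain ⟨a, b, hab⟩ := hu
  refine ⟨a, ?_, ⟨u, b, by linarith [hab]⟩⟩
  have h := congrArg (fun z : ℤ => (z : ZMod e)) hab
  push_cast at h
  rw [ZMod.natCast_self, mul_zero, add_zero] at h
  rw [mul_comm]; exact h

/-- Squarefree bookkeeping for the substitution: for squarefree `d₁` and `d ∣ [d₁, d₂]` (or any `d`),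
with `g = (d, d₁)`, `e = d₁/g`: `d₁ = g e`, `(g, e) = 1`, `e` squarefree, and `(d, e) = 1`. [folklore] -/
theorem progression_moduli {d d₁ : ℕ} (hd₁ : Squarefree d₁) :
    d₁ = Nat.gcd d d₁ * (d₁ / Nat.gcd d d₁) ∧ (Nat.gcd d d₁).Coprime (d₁ / Nat.gcd d d₁) ∧
      Squarefree (d₁ / Nat.gcd d d₁) ∧ d.Coprime (d₁ / Nat.gcd d d₁) := by
  set g := Nat.gcd d d₁ with hg
  have hgd₁ : g ∣ d₁ := Nat.gcd_dvd_right d d₁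
  have hdec : d₁ = g * (d₁ / g) := (Nat.mul_div_cancel' hgd₁).symm
  have hcop : g.Coprime (d₁ / g) := by
    have := hd₁; rw [hdec] at this
    exact Nat.coprime_of_squarefree_mul this
  refine ⟨hdec, hcop, ?_, ?_⟩
  · exact (hdec ▸ hd₁).of_mul_right
  · -- a prime dividing `d` and `d₁/g` divides `g`, contradicting `(g, d₁/g) = 1`
    refine Nat.coprime_of_dvd fun p hp hpd hpe => ?_
    have hpg : p ∣ g := Nat.dvd_gcd hpd (hpe.trans (Nat.div_dvd_of_dvd hgd₁))
    exact (Nat.Prime.one_lt hp).ne'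
      ((Nat.coprime_self p).mp (Nat.Coprime.coprime_dvd_left hpg (hcop.coprime_dvd_right hpe)))

/-- **The two-phase product along a progression** `n = n'd + t`: with `g_i = (d, d_i)`, `e_i = d_i/g_i`
and inverses `(g_i d) v_i ≡ 1`, `d w_i ≡ 1 (mod e_i)`,
`e_{d₁}(c₁/(n'd+t+l₁)) e_{d₂}(c₂/(n'd+t+l₂)) = K · e_{e₁}((c₁v₁)/(n' + (t+l₁)w₁)) e_{e₂}((c₂v₂)/(n' + (t+l₂)w₂))`
with the constant `K = e_{g₁}(c₁/(e₁(t+l₁))) e_{g₂}(c₂/(e₂(t+l₂)))` of modulus `≤ 1`.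
[cite: Polymath8a2014, Corollary 4.16, proof] -/
theorem twoPhase_comp_progression {d₁ d₂ : ℕ} [NeZero d₁] [NeZero d₂] (hd₁ : Squarefree d₁)
    (hd₂ : Squarefree d₂) (d : ℕ) [NeZero (Nat.gcd d d₁)] [NeZero (Nat.gcd d d₂)]
    [NeZero (d₁ / Nat.gcd d d₁)] [NeZero (d₂ / Nat.gcd d d₂)] {v₁ w₁ v₂ w₂ : ℤ}
    (hv₁ : ((Nat.gcd d d₁ * d : ℕ) : ZMod (d₁ / Nat.gcd d d₁)) * (v₁ : ZMod (d₁ / Nat.gcd d d₁)) = 1)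
    (hw₁ : (d : ZMod (d₁ / Nat.gcd d d₁)) * (w₁ : ZMod (d₁ / Nat.gcd d d₁)) = 1)
    (hv₂ : ((Nat.gcd d d₂ * d : ℕ) : ZMod (d₂ / Nat.gcd d d₂)) * (v₂ : ZMod (d₂ / Nat.gcd d d₂)) = 1)
    (hw₂ : (d : ZMod (d₂ / Nat.gcd d d₂)) * (w₂ : ZMod (d₂ / Nat.gcd d d₂)) = 1)
    (c₁ c₂ l₁ l₂ t n' : ℤ) :
    eFrac d₁ c₁ (d * n' + t + l₁) * eFrac d₂ c₂ (d * n' + t + l₂) =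
      (eFrac (Nat.gcd d d₁) c₁ ((d₁ / Nat.gcd d d₁ : ℕ) * (t + l₁)) *
        eFrac (Nat.gcd d d₂) c₂ ((d₂ / Nat.gcd d d₂ : ℕ) * (t + l₂))) *
      (eFrac (d₁ / Nat.gcd d d₁) (c₁ * v₁) (n' + (t + l₁) * w₁) *
        eFrac (d₂ / Nat.gcd d d₂) (c₂ * v₂) (n' + (t + l₂) * w₂)) := by
  obtain ⟨hdec₁, hcop₁, -, -⟩ := progression_moduli (d := d) hd₁
  obtain ⟨hdec₂, hcop₂, -, -⟩ := progression_moduli (d := d) hd₂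
  haveI : NeZero (Nat.gcd d d₁ * (d₁ / Nat.gcd d d₁)) := ⟨hdec₁ ▸ NeZero.ne d₁⟩
  haveI : NeZero (Nat.gcd d d₂ * (d₂ / Nat.gcd d d₂)) := ⟨hdec₂ ▸ NeZero.ne d₂⟩
  rw [eFrac_modulus_congr hdec₁, eFrac_modulus_congr hdec₂,
    eFrac_comp_progression hcop₁ (Nat.gcd_dvd_left d d₁) hv₁ hw₁,
    eFrac_comp_progression hcop₂ (Nat.gcd_dvd_left d d₂) hv₂ hw₂]
  ring

/-! ### The weighted sum along the progression -/

/-- **Reindexing along the progression**: for `d ≥ 1`,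
`∑_{k ≡ t (d)} ψ((k−x₀)/M) F(k) = ∑_{n'} ψ((n' − x₀')/(M/d)) F(n'd + t)`, `x₀' = (x₀ − t)/d`.
[cite: Polymath8a2014, Corollary 4.16, proof ("with `N` replaced by `N/d`, and with suitable
modifications to `x₀`")] -/
theorem tsum_progression_eq {ψ : ℝ → ℂ} {M : ℝ} (x₀ : ℝ) {d : ℕ} (hd : d ≠ 0) (t : ℤ) (F : ℤ → ℂ) :
    ∑' k : ℤ, ψ ((k - x₀) / M) * (if (d : ℤ) ∣ k - t then F k else 0) =
      ∑' n' : ℤ, ψ ((n' - (x₀ - t) / d) / (M / d)) * F (d * n' + t) := by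
  have hdR : (d : ℝ) ≠ 0 := by exact_mod_cast hd
  have hinj : Function.Injective fun n' : ℤ => (d : ℤ) * n' + t := by
    intro a b hab
    have : (d : ℤ) * a = d * b := by linarith [hab]
    exact mul_left_cancel₀ (by exact_mod_cast hd) this
  rw [← hinj.tsum_eq (f := fun k : ℤ => ψ ((k - x₀) / M) * (if (d : ℤ) ∣ k - t then F k else 0))]
  · refine tsum_congr fun n' => ?_
    rw [if_pos ⟨n', by ring⟩]
    congr 2
    push_cast
    field_simp
    ring
  · intro k hk
    rw [Function.mem_support] at hk
    by_cases hdk : (d : ℤ) ∣ k - t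
    · obtain ⟨n', hn'⟩ := hdk
      exact ⟨n', show (d : ℤ) * n' + t = k by linarith⟩
    · exfalso; apply hk; rw [if_neg hdk, mul_zero]

/-! ### Corollary 4.16 along a progression -/

/-- **Polymath 8a, Corollary 4.16, second bound, along a progression `n ≡ t (mod d)`** (the form used in
Proposition 5.10): for squarefree `d₁, d₂`, any `d ≥ 1` and `t`, with `e_i = d_i/(d, d_i)`,
`q' = [e₁, e₂]`, `M₁ = M/d`, `x₁ = (x₀ − t)/d`,
`|∑_{k ≡ t (d)} ψ((k−x₀)/M) e_{d₁}(c₁/(k+l₁)) e_{d₂}(c₂/(k+l₂))|`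
`≤ (|M₁'|/q')(c₁, e₁/(e₁,e₂))(c₂, e₂/(e₁,e₂))(e₁,e₂) + (M₁/q')(∫|ψ|) C^{ω(q')} √q' 2τ(q')H + q' · 2(∫|ψ^{(n)}|)(q'/(2πM₁))^n (M₁/q') H^{1−n}`
(`M₁' = ∑_m ψ((m − x₁)/M₁)`), i.e. the printed `≪ q^ε (d^{−1/2} q^{1/2} + d^{−1} N (c₁,δ₁')(c₂,δ₂')/(δ₁'δ₂'))`
with `δ_i' = δ_i/(d, δ_i)` (`= e_i/(e₁,e₂)`) and `(d₁', d₂') = (e₁, e₂)`: the substitution `n = n'd + t`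
(`tsum_progression_eq`, `twoPhase_comp_progression`) followed by `corollary_4_16_one` at scale `M/d`.
Weil's bound for the three-pole local sums (Lemma 4.2) is the hypothesis `hW`.
[cite: Polymath8a2014, Corollary 4.16] -/
theorem corollary_4_16_progression {ψ : ℝ → ℂ} (hψ : ContDiff ℝ ∞ ψ) (hψc : HasCompactSupport ψ)
    {M : ℝ} (hM : 0 < M) (x₀ : ℝ) {d₁ d₂ : ℕ} [NeZero d₁] [NeZero d₂] (hd₁ : Squarefree d₁)
    (hd₂ : Squarefree d₂) {d : ℕ} (hd : d ≠ 0) (t : ℤ) (c₁ c₂ l₁ l₂ : ℤ) {e₁ e₂ q' : ℕ}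
    (he₁ : d₁ / Nat.gcd d d₁ = e₁) (he₂ : d₂ / Nat.gcd d d₂ = e₂) (hq' : Nat.lcm e₁ e₂ = q')
    {H : ℕ} (hH : 1 ≤ H) {n : ℕ} (hn : 2 ≤ n) {C : ℝ} (hC : 3 ≤ C)
    (hW : ∀ p : ℕ, (hp : p.Prime) → p ∣ d₁ → p ∣ d₂ → ∀ (a₁ a₂ k₁ k₂ t : ℤ),
      ¬ (p : ℤ) ∣ a₁ → ¬ (p : ℤ) ∣ a₂ → ¬ (p : ℤ) ∣ k₂ - k₁ → ¬ (p : ℤ) ∣ t →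
      (haveI : NeZero p := ⟨hp.ne_zero⟩;
        ‖∑ j ∈ Finset.range p, eFrac p a₁ (j + k₁) * eFrac p a₂ (j + k₂) *
          (ZMod.stdAddChar ((j * t : ℤ) : ZMod p) : ℂ)‖ ≤ C * Real.sqrt p)) :
    ‖∑' k : ℤ, ψ ((k - x₀) / M) *
        (if (d : ℤ) ∣ k - t then eFrac d₁ c₁ (k + l₁) * eFrac d₂ c₂ (k + l₂) else 0)‖ ≤
      ‖∑' m : ℤ, ψ ((m - (x₀ - t) / d) / (M / d))‖ / q' *
          (Int.gcd c₁ (e₁ / Nat.gcd e₁ e₂ : ℕ) * Int.gcd c₂ (e₂ / Nat.gcd e₁ e₂ : ℕ) * Nat.gcd e₁ e₂) +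
      (M / d) / q' * (∫ s, ‖ψ s‖) * (C ^ q'.primeFactors.card * Real.sqrt q' * (2 * q'.divisors.card * H)) +
      q' * (2 * (∫ s, ‖iteratedDeriv n ψ s‖) * ((q' : ℝ) / (2 * π * (M / d))) ^ n * ((M / d) / q') *
        ((H : ℝ) ^ (n - 1))⁻¹) := by
  subst he₁; subst he₂; subst hq'
  obtain ⟨hdec₁, hcop₁, hsf₁, hdcop₁⟩ := progression_moduli (d := d) hd₁
  obtain ⟨hdec₂, hcop₂, hsf₂, hdcop₂⟩ := progression_moduli (d := d) hd₂
  haveI : NeZero (Nat.gcd d d₁) := ⟨Nat.gcd_ne_zero_right (NeZero.ne d₁)⟩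
  haveI : NeZero (Nat.gcd d d₂) := ⟨Nat.gcd_ne_zero_right (NeZero.ne d₂)⟩
  haveI : NeZero (d₁ / Nat.gcd d d₁) := ⟨hsf₁.ne_zero⟩
  haveI : NeZero (d₂ / Nat.gcd d d₂) := ⟨hsf₂.ne_zero⟩
  haveI : NeZero (Nat.lcm (d₁ / Nat.gcd d d₁) (d₂ / Nat.gcd d d₂)) := ⟨Nat.lcm_ne_zero hsf₁.ne_zero hsf₂.ne_zero⟩
  -- inverses modulo `e₁`, `e₂`
  have hc₁ : IsCoprime (((Nat.gcd d d₁ * d : ℕ) : ℤ)) ((d₁ / Nat.gcd d d₁ : ℕ) : ℤ) := by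
    push_cast
    exact IsCoprime.mul_left (Nat.isCoprime_iff_coprime.mpr hcop₁) (Nat.isCoprime_iff_coprime.mpr hdcop₁)
  have hc₂ : IsCoprime (((Nat.gcd d d₂ * d : ℕ) : ℤ)) ((d₂ / Nat.gcd d d₂ : ℕ) : ℤ) := by
    push_cast
    exact IsCoprime.mul_left (Nat.isCoprime_iff_coprime.mpr hcop₂) (Nat.isCoprime_iff_coprime.mpr hdcop₂)
  obtain ⟨v₁, hv₁, hv₁c⟩ := exists_mul_intCast_eq_one hc₁
  obtain ⟨v₂, hv₂, hv₂c⟩ := exists_mul_intCast_eq_one hc₂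
  obtain ⟨w₁, hw₁, -⟩ := exists_mul_intCast_eq_one (Nat.isCoprime_iff_coprime.mpr hdcop₁)
  obtain ⟨w₂, hw₂, -⟩ := exists_mul_intCast_eq_one (Nat.isCoprime_iff_coprime.mpr hdcop₂)
  rw [Int.cast_natCast] at hv₁ hv₂ hw₁ hw₂
  -- the substitution
  rw [tsum_progression_eq x₀ hd t]
  have hprod : ∀ n' : ℤ, ψ ((n' - (x₀ - t) / d) / (M / d)) *
      (eFrac d₁ c₁ (d * n' + t + l₁) * eFrac d₂ c₂ (d * n' + t + l₂)) =
      (eFrac (Nat.gcd d d₁) c₁ ((d₁ / Nat.gcd d d₁ : ℕ) * (t + l₁)) *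
        eFrac (Nat.gcd d d₂) c₂ ((d₂ / Nat.gcd d d₂ : ℕ) * (t + l₂))) *
      (ψ ((n' - (x₀ - t) / d) / (M / d)) *
        (eFrac (d₁ / Nat.gcd d d₁) (c₁ * v₁) (n' + (t + l₁) * w₁) *
          eFrac (d₂ / Nat.gcd d d₂) (c₂ * v₂) (n' + (t + l₂) * w₂))) := by
    intro n'
    rw [twoPhase_comp_progression hd₁ hd₂ d hv₁ hw₁ hv₂ hw₂]; ring
  simp only [hprod, tsum_mul_left, norm_mul]
  -- the constant has modulus `≤ 1`
  have hK : ‖eFrac (Nat.gcd d d₁) c₁ ((d₁ / Nat.gcd d d₁ : ℕ) * (t + l₁))‖ *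
      ‖eFrac (Nat.gcd d d₂) c₂ ((d₂ / Nat.gcd d d₂ : ℕ) * (t + l₂))‖ ≤ 1 :=
    mul_le_one₀ (norm_eFrac_le_one _ _) (norm_nonneg _) (norm_eFrac_le_one _ _)
  -- Corollary 4.16 with `d = 1` at scale `M/d`
  have hMd : 0 < M / d := div_pos hM (by exact_mod_cast Nat.pos_of_ne_zero hd)
  have hW' : ∀ p : ℕ, (hp : p.Prime) → p ∣ d₁ / Nat.gcd d d₁ → p ∣ d₂ / Nat.gcd d d₂ →
      ∀ (a₁ a₂ k₁ k₂ t : ℤ), ¬ (p : ℤ) ∣ a₁ → ¬ (p : ℤ) ∣ a₂ → ¬ (p : ℤ) ∣ k₂ - k₁ → ¬ (p : ℤ) ∣ t →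
      (haveI : NeZero p := ⟨hp.ne_zero⟩;
        ‖∑ j ∈ Finset.range p, eFrac p a₁ (j + k₁) * eFrac p a₂ (j + k₂) *
          (ZMod.stdAddChar ((j * t : ℤ) : ZMod p) : ℂ)‖ ≤ C * Real.sqrt p) :=
    fun p hp h₁ h₂ => hW p hp (h₁.trans (Nat.div_dvd_of_dvd (Nat.gcd_dvd_right d d₁)))
      (h₂.trans (Nat.div_dvd_of_dvd (Nat.gcd_dvd_right d d₂)))
  have h416 := corollary_4_16_one hψ hψc hMd ((x₀ - t) / d) hsf₁ hsf₂ rfl (c₁ * v₁) (c₂ * v₂)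
    ((t + l₁) * w₁) ((t + l₂) * w₂) hH hn hC hW'
  -- the gcd factors do not see the units `v_i`
  have hg₁ : Int.gcd (c₁ * v₁) ((d₁ / Nat.gcd d d₁) / Nat.gcd (d₁ / Nat.gcd d d₁) (d₂ / Nat.gcd d d₂) : ℕ) =
      Int.gcd c₁ ((d₁ / Nat.gcd d d₁) / Nat.gcd (d₁ / Nat.gcd d d₁) (d₂ / Nat.gcd d d₂) : ℕ) :=
    int_gcd_mul_right_of_isCoprime c₁ (hv₁c.of_isCoprime_of_dvd_right
      (Int.natCast_dvd_natCast.mpr (Nat.div_dvd_of_dvd (Nat.gcd_dvd_left _ _))))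
  have hg₂ : Int.gcd (c₂ * v₂) ((d₂ / Nat.gcd d d₂) / Nat.gcd (d₁ / Nat.gcd d d₁) (d₂ / Nat.gcd d d₂) : ℕ) =
      Int.gcd c₂ ((d₂ / Nat.gcd d d₂) / Nat.gcd (d₁ / Nat.gcd d d₁) (d₂ / Nat.gcd d d₂) : ℕ) :=
    int_gcd_mul_right_of_isCoprime c₂ (hv₂c.of_isCoprime_of_dvd_right
      (Int.natCast_dvd_natCast.mpr (Nat.div_dvd_of_dvd (Nat.gcd_dvd_right _ _))))
  rw [hg₁, hg₂] at h416
  calc _ ≤ 1 * _ := mul_le_mul hK h416 (norm_nonneg _) zero_le_one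
    _ = _ := one_mul _

end Polymath8a

end Literature.NumberTheory.Sieve
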